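import Summits.ValiantsHypothesis.ValiantsHypothesis.Theorems.DepthWindowLowBiasRound

/-!
# Route `DepthWindow` — low-bias trees: GRAFTING fibre trees under a quotient tree

Cone-free helper (decomp-valiant lens 4, g15) supporting the crux item `HomImmHardTwoOne`
(stmt-ValiantsHypothesis-30635).  `DepthWindowLowBiasRound` proved the one-round substitution principle
(`lowBiasTree_succ_of_quotient`: groups of mass `≤ β` hung under the leaves of a quotient tree).  This file is
its many-round form, the tool that lets a universal builder work on several sub-words IN PARALLEL:

* `lowBiasTree_graft` — if the letters are grouped by an onto map `c : Fin d → Fin M`, every FIBRE word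
  `w ∘ emb c m` (the letters of group `m`, enumerated) has a low-bias tree of depth `R ≥ 1` and node bias `≤ β`,
  and the QUOTIENT word `quotWord w c` (group sums) has one of depth `Δ`, then `w` has one of depth `R + Δ`
  (levels `< R` are the fibre trees side by side, level `R` is the partition into fibres, the levels above are
  the quotient tree pulled back).

With `R = 1` this is `lowBiasTree_succ_of_quotient` again (a depth-`1` fibre tree is a star whose root bias is
the group mass).  Intended use: cut a word with `k` letter values into two-valued pools, run the two-letter
builder of `DepthWindowTwoLetterULB` on every pool, and merge the pool sums with the interval tree of
`DepthWindowNodeBiasPerm` (`lowBiasTree_clog_of_bounded`).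

References: [LimayeSrinivasanTavenas2022] CCC 2022 (LIPIcs 234:32) Def. 2; full version ECCC TR22-090 Def. 15,
Prop. 16–17.
-/

-- layout Summits/ValiantsHypothesis/ValiantsHypothesis forces the duplicated namespace component
set_option linter.dupNamespace false

namespace Summit.ValiantsHypothesis.ValiantsHypothesis.Theorems.DepthWindow.TreeBias

open Finset

variable {d M : ℕ} (c : Fin d → Fin M)

/-! ### Fibres of a grouping map and their enumerations -/

/-- The fibre (group) of `m` under the grouping `c`. [folklore] -/
def fib (m : Fin M) : Finset (Fin d) := univ.filter fun j => c j = m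

/-- Membership in a fibre. [folklore] -/
theorem mem_fib {m : Fin M} {j : Fin d} : j ∈ fib c m ↔ c j = m := by simp [fib]

/-- An enumeration of the fibre of `m` by `Fin (card)`. [folklore] -/
noncomputable def emb (m : Fin M) (i : Fin (fib c m).card) : Fin d := ((fib c m).equivFin.symm i : fib c m)

/-- The enumeration lands in the fibre. [folklore] -/
theorem c_emb (m : Fin M) (i : Fin (fib c m).card) : c (emb c m i) = m :=
  (mem_fib c).1 ((fib c m).equivFin.symm i).2

/-- The enumeration is injective. [folklore] -/
theorem emb_injective (m : Fin M) : Function.Injective (emb c m) := fun _ _ h =>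
  (fib c m).equivFin.symm.injective (Subtype.ext h)

/-- The position of a letter inside its own fibre. [folklore] -/
noncomputable def idx (j : Fin d) : Fin (fib c (c j)).card := (fib c (c j)).equivFin ⟨j, (mem_fib c).2 rfl⟩

/-- Enumerating the position of `j` gives back `j`. [folklore] -/
theorem emb_idx (j : Fin d) : emb c (c j) (idx c j) = j := by
  simp [emb, idx]

/-- Every letter is enumerated by its fibre. [folklore] -/
theorem exists_emb (j : Fin d) : ∃ m i, emb c m i = j := ⟨c j, idx c j, emb_idx c j⟩

/-- The fibre word `w ∘ emb c m` sums to the quotient letter `quotWord w c m`. [folklore] -/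
theorem sum_comp_emb (w : Fin d → ℤ) (m : Fin M) : ∑ i, w (emb c m i) = quotWord w c m := by
  unfold quotWord emb
  rw [show (univ.filter fun i => c i = m) = fib c m from rfl, ← sum_coe_sort (fib c m)]
  exact (fib c m).equivFin.symm.sum_comp (fun j : fib c m => w j)

/-- Dependent rewriting across fibres: enumerated labels of provably equal fibres agree. [folklore] -/
theorem emb_lab_congr (T : ∀ m, LTree (fib c m).card) {m m' : Fin M} (e : m' = m) (i' : Fin (fib c m').card)
    (i : Fin (fib c m).card) (h : emb c m' i' = emb c m i) (u : ℕ) :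
    emb c m' ((T m').lab u i') = emb c m ((T m).lab u i) := by
  subst e
  obtain rfl := emb_injective c _ h
  rfl

/-! ### The grafted tree -/

section graft

variable (hc : Function.Surjective c) (T : ∀ m, LTree (fib c m).card) (T' : LTree M) (R : ℕ)

/-- Labels of the grafted tree: below level `R` the fibre trees (re-embedded), from level `R` on the quotient
tree pulled back along `c` through the section `grpRep`. [folklore] -/
noncomputable def graftLab (u : ℕ) (j : Fin d) : Fin d :=
  if u < R then emb c (c j) ((T (c j)).lab u (idx c j)) else grpRep c hc (T'.lab (u - R) (c j))

/-- Below level `R`, on an enumerated letter, the label is the enumerated fibre label. [folklore] -/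
theorem graftLab_emb {u : ℕ} (hu : u < R) (m : Fin M) (i : Fin (fib c m).card) :
    graftLab c hc T T' R u (emb c m i) = emb c m ((T m).lab u i) := by
  unfold graftLab
  rw [if_pos hu]
  exact emb_lab_congr c T (c_emb c m i) (idx c (emb c m i)) i (emb_idx c (emb c m i)) u

/-- From level `R` on the label is the pulled-back quotient label. [folklore] -/
theorem graftLab_of_le {u : ℕ} (hu : R ≤ u) (j : Fin d) :
    graftLab c hc T T' R u j = grpRep c hc (T'.lab (u - R) (c j)) := by
  unfold graftLab
  rw [if_neg (not_lt.2 hu)]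

/-- At level `R` the blocks are the fibres. [folklore] -/
theorem graftLab_self (j : Fin d) : graftLab c hc T T' R R j = grpRep c hc (c j) := by
  rw [graftLab_of_le c hc T T' R le_rfl, Nat.sub_self, T'.leaf]

/-- Up to level `R` labels stay inside their fibre. [folklore] -/
theorem c_graftLab {u : ℕ} (hu : u ≤ R) (j : Fin d) : c (graftLab c hc T T' R u j) = c j := by
  rcases hu.lt_or_eq with hu | rfl
  · unfold graftLab; rw [if_pos hu, c_emb c]
  · rw [graftLab_self, c_grpRep c hc]

/-- Up to level `R`, two letters of one fibre share a label iff they share the fibre-tree label (at level `R`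
itself both sides hold, given the root condition of the fibre tree). [folklore] -/
theorem graftLab_emb_eq_iff {u : ℕ} (hu : u ≤ R) (m : Fin M)
    (hroot : u = R → ∀ i i', (T m).lab R i = (T m).lab R i') (i i' : Fin (fib c m).card) :
    graftLab c hc T T' R u (emb c m i') = graftLab c hc T T' R u (emb c m i) ↔
      (T m).lab u i' = (T m).lab u i := by
  rcases hu.lt_or_eq with hu | rfl
  · rw [graftLab_emb c hc T T' R hu, graftLab_emb c hc T T' R hu, (emb_injective c m).eq_iff]
  · rw [graftLab_self, graftLab_self, c_emb c, c_emb c]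
    exact ⟨fun _ => hroot rfl i' i, fun _ => rfl⟩

/-- **Grafted tree**: below level `R` the fibre trees `T m` side by side, from level `R` on the quotient tree
`T'` pulled back along `c` (level `R` itself is the partition into fibres since `T'.lab 0 = id`). [folklore] -/
noncomputable def LTree.graft (hR : 0 < R) : LTree d where
  lab := graftLab c hc T T' R
  leaf j := by
    unfold graftLab
    rw [if_pos hR, (T (c j)).leaf]
    exact emb_idx c j
  refine u j j' h := by
    by_cases hu : u < R
    · obtain ⟨m, i, rfl⟩ := exists_emb c j
      obtain ⟨m', i', rfl⟩ := exists_emb c j'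
      have hmm : m' = m := by
        have := congrArg c h
        rwa [c_graftLab c hc T T' R hu.le, c_graftLab c hc T T' R hu.le, c_emb c, c_emb c, eq_comm] at this
      subst hmm
      have hlab : (T m').lab u i' = (T m').lab u i :=
        (graftLab_emb_eq_iff c hc T T' R hu.le m' (fun h => absurd h hu.ne) i i').1 h.symm
      have href := (T m').refine u i' i hlab
      rcases (show u + 1 < R ∨ u + 1 = R by omega) with hu1 | hu1
      · rw [graftLab_emb c hc T T' R hu1, graftLab_emb c hc T T' R hu1, href]
      · rw [hu1, graftLab_self, graftLab_self, c_emb c, c_emb c]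
    · rw [not_lt] at hu
      rw [graftLab_of_le c hc T T' R hu, graftLab_of_le c hc T T' R hu] at h
      have h' := T'.refine (u - R) (c j) (c j') (grpRep_injective c hc h)
      rw [graftLab_of_le c hc T T' R (by omega), graftLab_of_le c hc T T' R (by omega),
        show u + 1 - R = u - R + 1 by omega, h']

/-- The label function of the grafted tree. [folklore] -/
theorem graft_lab (hR : 0 < R) : (LTree.graft c hc T T' R hR).lab = graftLab c hc T T' R := rfl

/-! ### Block sums of the grafted tree -/

/-- Below level `R` the blocks are re-embedded fibre-tree blocks, with the same sums. [folklore] -/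
theorem blockSum_graft_lt (hR : 0 < R) (w : Fin d → ℤ) {u : ℕ} (hu : u < R) (m : Fin M)
    (l : Fin (fib c m).card) :
    blockSum w (LTree.graft c hc T T' R hR) u (emb c m l) = blockSum (w ∘ emb c m) (T m) u l := by
  unfold blockSum
  have hset : (univ.filter fun j => (LTree.graft c hc T T' R hR).lab u j = emb c m l) =
      (univ.filter fun i => (T m).lab u i = l).image (emb c m) := by
    ext j
    simp only [mem_filter, mem_univ, true_and, mem_image, graft_lab]
    constructor
    · intro hj
      obtain ⟨m', i', rfl⟩ := exists_emb c j
      have hmm : m' = m := by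
        have := congrArg c hj
        rwa [c_graftLab c hc T T' R hu.le, c_emb c, c_emb c] at this
      subst hmm
      rw [graftLab_emb c hc T T' R hu] at hj
      exact ⟨i', emb_injective c m' hj, rfl⟩
    · rintro ⟨i', hi', rfl⟩
      rw [graftLab_emb c hc T T' R hu, hi']
  rw [hset, sum_image fun x _ y _ h => emb_injective c m h]
  rfl

/-- From level `R` on the blocks are unions of fibres: their sums are block sums of the quotient word.
[folklore] -/
theorem blockSum_graft_ge (hR : 0 < R) (w : Fin d → ℤ) (v : ℕ) (l : Fin M) :
    blockSum w (LTree.graft c hc T T' R hR) (R + v) (grpRep c hc l) = blockSum (quotWord w c) T' v l := by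
  unfold blockSum quotWord
  have hfilter : (univ.filter fun j => (LTree.graft c hc T T' R hR).lab (R + v) j = grpRep c hc l) =
      univ.filter fun j => T'.lab v (c j) = l := by
    ext j
    simp only [mem_filter, mem_univ, true_and, graft_lab]
    rw [graftLab_of_le c hc T T' R (Nat.le_add_right R v), Nat.add_sub_cancel_left]
    exact (grpRep_injective c hc).eq_iff
  rw [hfilter]
  rw [← sum_fiberwise_of_maps_to (s := univ.filter fun j => T'.lab v (c j) = l)
    (t := univ.filter fun m => T'.lab v m = l) (g := c) (fun j hj => by simpa using hj) w]
  refine sum_congr rfl fun m hm => sum_congr ?_ fun _ _ => rfl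
  ext j
  simp only [mem_filter, mem_univ, true_and]
  constructor
  · rintro ⟨-, rfl⟩; trivial
  · rintro rfl; exact ⟨by simpa using hm, rfl⟩

/-! ### Node biases of the grafted tree -/

/-- At levels `1 ≤ u ≤ R` the node biases are those of the fibre trees (at level `R` given the fibre tree's
root condition). [cite: LimayeSrinivasanTavenas2022, Def. 15] -/
theorem nodeBias_graft_le (hR : 0 < R) (w : Fin d → ℤ) {u : ℕ} (hu1 : 1 ≤ u) (hu : u ≤ R) (m : Fin M)
    (hroot : u = R → ∀ i i', (T m).lab R i = (T m).lab R i') (i : Fin (fib c m).card) :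
    nodeBias w (LTree.graft c hc T T' R hR) u (emb c m i) = nodeBias (w ∘ emb c m) (T m) u i := by
  unfold nodeBias
  have hu' : u - 1 < R := by omega
  have hset : (univ.filter fun j => (LTree.graft c hc T T' R hR).lab u j =
        (LTree.graft c hc T T' R hR).lab u (emb c m i)).image ((LTree.graft c hc T T' R hR).lab (u - 1)) =
      ((univ.filter fun i' => (T m).lab u i' = (T m).lab u i).image ((T m).lab (u - 1))).image (emb c m) := by
    ext l
    simp only [mem_image, mem_filter, mem_univ, true_and, graft_lab]
    constructor
    · rintro ⟨j, hj, rfl⟩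
      obtain ⟨m', i', rfl⟩ := exists_emb c j
      have hmm : m' = m := by
        have := congrArg c hj
        rwa [c_graftLab c hc T T' R hu, c_graftLab c hc T T' R hu, c_emb c, c_emb c] at this
      subst hmm
      refine ⟨(T m').lab (u - 1) i', ⟨i', (graftLab_emb_eq_iff c hc T T' R hu m' hroot i i').1 hj, rfl⟩, ?_⟩
      rw [graftLab_emb c hc T T' R hu']
    · rintro ⟨l', ⟨i', hi', rfl⟩, rfl⟩
      refine ⟨emb c m i', (graftLab_emb_eq_iff c hc T T' R hu m hroot i i').2 hi', ?_⟩
      rw [graftLab_emb c hc T T' R hu']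
  rw [hset, sum_image fun x _ y _ h => emb_injective c m h]
  exact sum_congr rfl fun l' _ => by rw [blockSum_graft_lt c hc T T' R hR w hu']

/-- At levels `R + v`, `v ≥ 1`, the node biases are those of the quotient tree at level `v`.
[cite: LimayeSrinivasanTavenas2022, Def. 15] -/
theorem nodeBias_graft_gt (hR : 0 < R) (w : Fin d → ℤ) {v : ℕ} (hv : 1 ≤ v) (j : Fin d) :
    nodeBias w (LTree.graft c hc T T' R hR) (R + v) j = nodeBias (quotWord w c) T' v (c j) := by
  unfold nodeBias
  obtain ⟨v', rfl⟩ : ∃ v', v = v' + 1 := ⟨v - 1, by omega⟩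
  rw [show R + (v' + 1) - 1 = R + v' by omega, show v' + 1 - 1 = v' from rfl]
  have hset : (univ.filter fun j' => (LTree.graft c hc T T' R hR).lab (R + (v' + 1)) j' =
        (LTree.graft c hc T T' R hR).lab (R + (v' + 1)) j).image
        ((LTree.graft c hc T T' R hR).lab (R + v')) =
      ((univ.filter fun m => T'.lab (v' + 1) m = T'.lab (v' + 1) (c j)).image (T'.lab v')).image
        (grpRep c hc) := by
    ext l
    simp only [mem_image, mem_filter, mem_univ, true_and, graft_lab,
      graftLab_of_le c hc T T' R (Nat.le_add_right R _), Nat.add_sub_cancel_left]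
    constructor
    · rintro ⟨j', hj', rfl⟩
      exact ⟨T'.lab v' (c j'), ⟨c j', grpRep_injective c hc hj', rfl⟩, rfl⟩
    · rintro ⟨l', ⟨m, hm, rfl⟩, rfl⟩
      obtain ⟨j', rfl⟩ := hc m
      exact ⟨j', by rw [hm], rfl⟩
  rw [hset, sum_image fun x _ y _ hxy => grpRep_injective c hc hxy]
  exact sum_congr rfl fun l' _ => by rw [blockSum_graft_ge]

/-! ### Grafting -/

/-- **Grafting.**  Group the letters of `w` by an onto map `c : Fin d → Fin M`.  If every fibre word
`w ∘ emb c m` has a low-bias tree of depth `R ≥ 1` and node bias `≤ β`, and the quotient word `quotWord w c` has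
one of depth `Δ`, then `w` has one of depth `R + Δ`. [cite: LimayeSrinivasanTavenas2022, Def. 15, Prop. 16] -/
theorem lowBiasTree_graft (hc : Function.Surjective c) {w : Fin d → ℤ} {β : ℤ} {R Δ : ℕ} (hR : 1 ≤ R)
    (hfib : ∀ m, LowBiasTree (w ∘ emb c m) R β) (hT' : LowBiasTree (quotWord w c) Δ β) :
    LowBiasTree w (R + Δ) β := by
  choose T hroot hnb using hfib
  obtain ⟨T', hroot', hnb'⟩ := hT'
  refine ⟨LTree.graft c hc T T' R hR, fun i j => ?_, fun u hu1 hu i => ?_⟩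
  · rw [graft_lab, graftLab_of_le c hc T T' R (Nat.le_add_right R Δ),
      graftLab_of_le c hc T T' R (Nat.le_add_right R Δ), Nat.add_sub_cancel_left, hroot' (c i) (c j)]
  · rcases le_or_gt u R with huR | huR
    · obtain ⟨m, i, rfl⟩ := exists_emb c i
      rw [nodeBias_graft_le c hc T T' R hR w hu1 huR m (fun _ => hroot m) i]
      exact hnb m u hu1 huR i
    · obtain ⟨v, rfl⟩ : ∃ v, u = R + v := ⟨u - R, by omega⟩
      rw [nodeBias_graft_gt c hc T T' R hR w (by omega) i]
      exact hnb' v (by omega) (by omega) (c i)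

end graft

end Summit.ValiantsHypothesis.ValiantsHypothesis.Theorems.DepthWindow.TreeBias
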